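import Literature.AlgebraicGeometry.ProjectiveSpace.LinearSubspaceHilbertFunction
import Mathlib.LinearAlgebra.Dimension.OrzechProperty
import Mathlib.LinearAlgebra.FiniteDimensional.Basic
import HarnessLib

/-!
# Harris, Exercise 13.8 (iii) for an arbitrary triple of concurrent non-coplanar lines of `ℙ³`

Topic `Literature/AlgebraicGeometry/ProjectiveSpace`, namespace
`Literature.AlgebraicGeometry.ProjectiveSpace`. Lane `lit-hodgefound`, seat `lit-hodgefound-p32`,
row gen27-#6. Theorems only (no `def`, no named fact). The coordinate-free form of
`StanleyReisnerHilbertFunction.hilbert_three_concurrent_noncoplanar_lines` (the coordinate axes through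
`[1:0:0:0]`), via the basis-matrix transport of `LinearSubspaceHilbertFunction`.

## The sources, as printed

J. Harris, *Algebraic Geometry: A First Course* (GTM 133), Lecture 1 (p. 4): "two varieties
`X, Y ⊂ ℙⁿ` are projectively equivalent if they are congruent modulo [`PGL_{n+1} K`]"; (p. 7) "any two
such [point] sets [in general position] are projectively equivalent"; Example 13.7 and **Exercise 13.8.**
"Determine the arithmetic genus of […] (iii) three concurrent but noncoplanar lines in `ℙ³` […]".

## Dictionary and what is here

Lines of `ℙ³ = ℙ(k⁴)` are planes `W ⊂ k⁴` (`finrank = 2`); three lines `ℙ(W₁), ℙ(W₂), ℙ(W₃)` are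
CONCURRENT at the point `[u]` when `0 ≠ u ∈ W₁ ∩ W₂ ∩ W₃`, and NON-COPLANAR when `W₁ + W₂ + W₃ = k⁴`
(then they are pairwise distinct and meet pairwise exactly in `[u]`). `H_Z(m) = dim S_m − dim I(Z)_m`
for the cone `Z = W₁ ∪ W₂ ∪ W₃`, `k` infinite.

* § 1 **an adapted basis**: vectors `w_i ∈ W_i` off the line `k u` give a basis `(u, w₁, w₂, w₃)` of
  `k⁴` with `W_i = span{u, w_i}` (`exists_basis_adapted_three_concurrent_lines`), so the change of
  coordinates of `LinearSubspaceHilbertFunction` carries the coordinate axes `x_j = x_l = 0` through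
  `[1:0:0:0]` onto the three lines (`union_three_concurrent_lines_eq_image`).
* § 2 **Exercise 13.8 (iii): `H(m) = 3m + 1` for every `m`** (`hilbert_three_concurrent_lines`):
  Hilbert polynomial `3m + 1`, arithmetic genus `1 − 1 = 0` — for every concurrent non-coplanar
  triple, "projectively equivalent" to the coordinate one.

## References

* [Harris1992] J. Harris, *Algebraic Geometry: A First Course*, GTM 133, Springer 1992, Lecture 1
  (pp. 4, 7), Lecture 13, Example 13.7 and Exercise 13.8 (iii) (p. 167).
* [BrunsHerzog1998] W. Bruns, J. Herzog, *Cohen–Macaulay Rings*, rev. ed., CUP 1998, Thm. 5.1.7 (the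
  coordinate count, `f`-vector `(4, 3)`).
-/

noncomputable section

open MvPolynomial Module Matrix
open Literature.RingTheory.MvPolynomial

universe u

namespace Literature.AlgebraicGeometry.ProjectiveSpace

variable {k : Type u} [Field k]

/-- `range ![a, b] = {a, b}`. [folklore] -/
private theorem range_vecCons_two {α : Type*} (a b : α) : Set.range ![a, b] = {a, b} := by
  ext x
  simp only [Set.mem_range, Set.mem_insert_iff, Set.mem_singleton_iff, Fin.exists_fin_two,
    Matrix.cons_val_zero, Matrix.cons_val_one]
  constructor <;> rintro (h | h) <;> simp [h]

/-- A plane containing `u ≠ 0` and a vector `w` off the line `k u` is `span{u, w}`. [folklore] -/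
private theorem eq_span_pair_of_mem {W : Submodule k (Fin 4 → k)} (hW : finrank k W = 2)
    {u w : Fin 4 → k} (hu : u ≠ 0) (huW : u ∈ W) (hwW : w ∈ W)
    (hw : w ∉ (k ∙ u : Submodule k (Fin 4 → k))) :
    Submodule.span k {u, w} = W := by
  have hli : LinearIndependent k ![u, w] := by
    rw [LinearIndependent.pair_symm_iff, linearIndependent_fin2]
    refine ⟨hu, fun a ha => hw ?_⟩
    exact Submodule.mem_span_singleton.mpr ⟨a, ha⟩
  have hle : Submodule.span k {u, w} ≤ W := by
    rw [Submodule.span_le]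
    rintro x (rfl | rfl)
    · exact huW
    · exact hwW
  refine Submodule.eq_of_le_of_finrank_eq hle ?_
  rw [hW, ← range_vecCons_two, finrank_span_eq_card hli, Fintype.card_fin]

/-- **A basis adapted to three concurrent non-coplanar lines**: if `0 ≠ u ∈ W₁ ∩ W₂ ∩ W₃` for planes
`W_i ⊂ k⁴` with `W₁ + W₂ + W₃ = k⁴`, there is a basis `b` of `k⁴` with `b₀ = u` and
`W_i = span{b₀, b_i}` (`i = 1, 2, 3`) — the triple is projectively equivalent to the coordinate axes
through `[1:0:0:0]`. [cite: Harris1992, Lecture 1 (pp. 4, 7)] -/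
theorem exists_basis_adapted_three_concurrent_lines {W₁ W₂ W₃ : Submodule k (Fin 4 → k)}
    (h₁ : finrank k W₁ = 2) (h₂ : finrank k W₂ = 2) (h₃ : finrank k W₃ = 2) {u : Fin 4 → k}
    (hu : u ≠ 0) (hu₁ : u ∈ W₁) (hu₂ : u ∈ W₂) (hu₃ : u ∈ W₃) (hsup : W₁ ⊔ W₂ ⊔ W₃ = ⊤) :
    ∃ b : Basis (Fin 4) k (Fin 4 → k), b 0 = u ∧
      Submodule.span k (b '' ↑({0, 1} : Finset (Fin 4))) = W₁ ∧
      Submodule.span k (b '' ↑({0, 2} : Finset (Fin 4))) = W₂ ∧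
      Submodule.span k (b '' ↑({0, 3} : Finset (Fin 4))) = W₃ := by
  -- vectors `w_i ∈ W_i` off the line `k u`
  have hline : finrank k (k ∙ u : Submodule k (Fin 4 → k)) = 1 := finrank_span_singleton hu
  have hlt : ∀ {W : Submodule k (Fin 4 → k)}, finrank k W = 2 → u ∈ W →
      ∃ w ∈ W, w ∉ (k ∙ u : Submodule k (Fin 4 → k)) := fun {W} hW huW =>
    SetLike.exists_of_lt (Submodule.lt_of_le_of_finrank_lt_finrank
      ((Submodule.span_singleton_le_iff_mem u W).mpr huW) (by rw [hline, hW]; norm_num))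
  obtain ⟨w₁, hw₁W, hw₁⟩ := hlt h₁ hu₁
  obtain ⟨w₂, hw₂W, hw₂⟩ := hlt h₂ hu₂
  obtain ⟨w₃, hw₃W, hw₃⟩ := hlt h₃ hu₃
  have hW₁ := eq_span_pair_of_mem h₁ hu hu₁ hw₁W hw₁
  have hW₂ := eq_span_pair_of_mem h₂ hu hu₂ hw₂W hw₂
  have hW₃ := eq_span_pair_of_mem h₃ hu hu₃ hw₃W hw₃
  -- `(u, w₁, w₂, w₃)` spans `k⁴ = W₁ + W₂ + W₃`, hence is a basis
  set v : Fin 4 → Fin 4 → k := ![u, w₁, w₂, w₃] with hv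
  have hpair : ∀ w : Fin 4 → k, w ∈ Set.range v → Submodule.span k {u, w} ≤ Submodule.span k (Set.range v) :=
    fun w hw => Submodule.span_mono (by
      rintro x (rfl | rfl)
      · exact ⟨0, by simp [hv]⟩
      · exact hw)
  have hle : (⊤ : Submodule k (Fin 4 → k)) ≤ Submodule.span k (Set.range v) := by
    rw [← hsup]
    refine sup_le (sup_le ?_ ?_) ?_
    · rw [← hW₁]; exact hpair w₁ ⟨1, by simp [hv]⟩
    · rw [← hW₂]; exact hpair w₂ ⟨2, by simp [hv]⟩
    · rw [← hW₃]; exact hpair w₃ ⟨3, by simp [hv]⟩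
  have hcard : Fintype.card (Fin 4) = finrank k (Fin 4 → k) := by
    rw [Fintype.card_fin, Module.finrank_fin_fun]
  refine ⟨basisOfTopLeSpanOfCardEqFinrank v hle hcard, ?_, ?_, ?_, ?_⟩ <;>
    simp only [coe_basisOfTopLeSpanOfCardEqFinrank, Finset.coe_pair, Set.image_pair]
  · simp [hv]
  · simpa [hv] using hW₁
  · simpa [hv] using hW₂
  · simpa [hv] using hW₃

/-- The union of three concurrent non-coplanar lines of `ℙ³` is the image of the coordinate axes
`x₂ = x₃ = 0`, `x₁ = x₃ = 0`, `x₁ = x₂ = 0` under the adapted change of coordinates.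
[cite: Harris1992, Lecture 1 (pp. 4, 7)] -/
theorem union_three_concurrent_lines_eq_image {W₁ W₂ W₃ : Submodule k (Fin 4 → k)}
    {b : Basis (Fin 4) k (Fin 4 → k)}
    (hW₁ : Submodule.span k (b '' ↑({0, 1} : Finset (Fin 4))) = W₁)
    (hW₂ : Submodule.span k (b '' ↑({0, 2} : Finset (Fin 4))) = W₂)
    (hW₃ : Submodule.span k (b '' ↑({0, 3} : Finset (Fin 4))) = W₃) :
    ((W₁ : Set (Fin 4 → k)) ∪ W₂ ∪ W₃) = (Matrix.mulVec (Matrix.of fun i j => b j i)) ''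
      {p : Fin 4 → k | (p 2 = 0 ∧ p 3 = 0) ∨ (p 1 = 0 ∧ p 3 = 0) ∨ (p 1 = 0 ∧ p 2 = 0)} := by
  have hset : {p : Fin 4 → k | (p 2 = 0 ∧ p 3 = 0) ∨ (p 1 = 0 ∧ p 3 = 0) ∨ (p 1 = 0 ∧ p 2 = 0)} =
      {p : Fin 4 → k | ∃ F ∈ ({{0, 1}, {0, 2}, {0, 3}} : Set (Finset (Fin 4))),
        ∀ i ∉ F, p i = 0} := by
    ext p
    simp only [Set.mem_setOf_eq, Set.mem_insert_iff, Set.mem_singleton_iff, exists_eq_or_imp,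
      exists_eq_left, Fin.forall_fin_succ, Fin.isValue]
    simp
  rw [hset, image_mulVec_of_basis_coordArrangement]
  ext x
  simp only [Set.mem_union, SetLike.mem_coe, Set.mem_setOf_eq, Set.mem_insert_iff,
    Set.mem_singleton_iff, exists_eq_or_imp, exists_eq_left]
  rw [hW₁, hW₂, hW₃, or_assoc]

/-- **Exercise 13.8 (iii) for an arbitrary triple of concurrent non-coplanar lines of `ℙ³`:
`H(m) = 3m + 1` for every `m`** (`k` infinite; planes `W_i ⊂ k⁴` of dimension `2` through a common
non-zero `u` with `W₁ + W₂ + W₃ = k⁴`): Hilbert polynomial `3m + 1`, arithmetic genus `0`.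
[cite: Harris1992, Exercise 13.8 (iii) and Lecture 1 (p. 4)] [cite: BrunsHerzog1998, Thm. 5.1.7] -/
theorem hilbert_three_concurrent_lines [Infinite k] {W₁ W₂ W₃ : Submodule k (Fin 4 → k)}
    (h₁ : finrank k W₁ = 2) (h₂ : finrank k W₂ = 2) (h₃ : finrank k W₃ = 2) {u : Fin 4 → k}
    (hu : u ≠ 0) (hu₁ : u ∈ W₁) (hu₂ : u ∈ W₂) (hu₃ : u ∈ W₃) (hsup : W₁ ⊔ W₂ ⊔ W₃ = ⊤) (m : ℕ) :
    finrank k (homogeneousSubmodule (Fin 4) k m) -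
        finrank k (idealDegree (projVanishingIdeal ((W₁ : Set (Fin 4 → k)) ∪ W₂ ∪ W₃)) m) =
      3 * m + 1 := by
  classical
  obtain ⟨b, -, hW₁, hW₂, hW₃⟩ :=
    exists_basis_adapted_three_concurrent_lines h₁ h₂ h₃ hu hu₁ hu₂ hu₃ hsup
  rw [union_three_concurrent_lines_eq_image hW₁ hW₂ hW₃,
    hilbert_projVanishingIdeal_image_mulVec (isUnit_det_of_basis b)]
  exact hilbert_three_concurrent_noncoplanar_lines m

end Literature.AlgebraicGeometry.ProjectiveSpace
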